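import Literature.Probability.Process.ConformalEnlargement
import Literature.Probability.Process.PathLawOfIncrements
import HarnessLib

/-!
# The enlarged time-changed process is a planar Brownian motion (law on path space)

Seventh file on P. Lévy's conformal invariance of planar Brownian motion (Lawler (2005),
Thm. 2.2: "`Y_t = f(B_{σ⁻¹(t)})` is a standard Brownian motion"; Le Gall (2016), Thm. 5.13 and
Thm. 7.19). With the enlarged time-changed process `β̃_u = Ỹ_u + W'_{(u−S)⁺}` of
`ConformalTimeChangeDefs` (on the product with the space of an independent planar Brownian motion
`W'`), we prove:

* `tcPos_zero`, `tcEnl_zero` — `Ỹ_0 = β̃_0 = f(x₀)`;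
* `continuous_tcEnl_of_ne_top` — on `{ρ < ∞}` the paths of `β̃` are continuous
  (`continuous_clockInvFun`; here `f' ≠ 0` on `D` is used);
* `map_mkD_tcEnl_eq` — **the law of the path of `β̃` on `C(ℝ≥0, ℂ)` is the law of the path of
  the planar Brownian motion `f(x₀) + W'`** (the increments have the Brownian joint characteristic
  functions, `integral_cexp_sum_tcEnl_incr`, and such laws are unique, `map_path_eq_of_incr`).

This is [Lawler] Thm. 2.2 for the motion stopped on leaving `U` (the statement about the killed,
time-changed path is read off in the sequel by restricting to times before the exit from `f(U)`).

## References

* G. F. Lawler, *Conformally Invariant Processes in the Plane*, AMS (2005), Thm. 2.2.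
* J.-F. Le Gall, *Brownian Motion, Martingales, and Stochastic Calculus* (2016), Thm. 5.13,
  Thm. 7.19.
-/

noncomputable section

open MeasureTheory ProbabilityTheory Filter Topology Set Complex
open scoped NNReal ENNReal BigOperators ComplexConjugate

namespace Literature.Probability.Process

variable {Ω Ω' : Type*} {mΩ : MeasurableSpace Ω} {mΩ' : MeasurableSpace Ω'} {P : Measure Ω}
  {P' : Measure Ω'} {W : ℝ≥0 → Ω → (Fin 2 → ℝ)} {W' : ℝ≥0 → Ω' → (Fin 2 → ℝ)}

/-- `toC 0 = 0`. [folklore] -/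
@[simp] theorem toC_zero : toC (0 : Fin 2 → ℝ) = 0 := by
  apply Complex.ext <;> simp

namespace IsBrownianVec

variable {x₀ : Fin 2 → ℝ} {U : Set (Fin 2 → ℝ)} {D : Set ℂ} {f : ℂ → ℂ}

/-! ### Starting point -/

/-- The inverse clock at level `0` is `0` (the clock starts at `0`). [folklore] -/
theorem clockInv_zero (ω : Ω) : clockInv x₀ W f U 0 ω = 0 := by
  have h1 : clockLevel x₀ W f U 0 ω ≤ ((0 : ℝ≥0) : WithTop ℝ≥0) :=
    hittingAfter_le_of_mem le_rfl (by rw [mem_Ici, confClock_zero]; exact le_rfl)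
  have h2 : clockLevel x₀ W f U 0 ω = 0 := le_antisymm h1 bot_le
  rw [clockInv, h2]
  exact min_eq_left bot_le

/-- The stopped position at the inverse clock of level `0` is `x₀`. [folklore] -/
theorem stoppedValue_confPos_clockInv_zero (hW : IsBrownianVec W P) (ω : Ω) :
    stoppedValue (confPos x₀ W U) (clockInv x₀ W f U 0) ω = x₀ := by
  rw [stoppedValue, clockInv_zero]
  show confPos x₀ W U 0 ω = x₀
  rw [confPos, stopT_zero, hW.apply_zero, add_zero]

/-- **`Ỹ_0 = f(x₀)`.** [folklore] -/
theorem tcPos_zero (hW : IsBrownianVec W P) (ω : Ω) : tcPos x₀ W f U 0 ω = f (toC x₀) := by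
  rw [tcPos, hW.stoppedValue_confPos_clockInv_zero]

/-- The total clock is nonnegative. [folklore] -/
theorem totClock_nonneg (hW : IsBrownianVec W P) (hD : IsOpen D) (hf : DifferentiableOn ℂ f D)
    (hU : IsOpen U) (hUD : closure U ⊆ toC ⁻¹' D) (hx₀ : x₀ ∈ U) (ω : Ω) : 0 ≤ totClock x₀ W f U ω := by
  have := hW.confClock_mono hD hf hU hUD hx₀ ω (show (0 : ℝ≥0) ≤ (hitTime x₀ W Uᶜ ω).untopA from bot_le)
  rwa [confClock_zero] at this

/-- **`β̃_0 = f(x₀)`.** [folklore] -/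
theorem tcEnl_zero (hW : IsBrownianVec W P) (hW' : IsBrownianVec W' P') (hD : IsOpen D)
    (hf : DifferentiableOn ℂ f D) (hU : IsOpen U) (hUD : closure U ⊆ toC ⁻¹' D) (hx₀ : x₀ ∈ U)
    (p : Ω × Ω') : tcEnl x₀ W f U W' 0 p = f (toC x₀) := by
  rw [tcEnl, hW.tcPos_zero, NNReal.coe_zero, zero_sub,
    Real.toNNReal_of_nonpos (neg_nonpos.2 (hW.totClock_nonneg hD hf hU hUD hx₀ p.1)), hW'.apply_zero,
    toC_zero, add_zero]

/-! ### Continuity of the paths on `{ρ < ∞}` -/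

/-- **On `{ρ < ∞}` the time-changed process has continuous paths.** [folklore] -/
theorem continuous_tcPos_of_ne_top (hW : IsBrownianVec W P) (hD : IsOpen D) (hf : DifferentiableOn ℂ f D)
    (hf' : ∀ z ∈ D, deriv f z ≠ 0) (hU : IsOpen U) (hUc : IsCompact (closure U))
    (hUD : closure U ⊆ toC ⁻¹' D) (hx₀ : x₀ ∈ U) {ω : Ω} (hρ : hitTime x₀ W Uᶜ ω ≠ ⊤) :
    Continuous fun u ↦ tcPos x₀ W f U u ω := by
  obtain ⟨T, hT⟩ := WithTop.ne_top_iff_exists.1 hρ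
  obtain ⟨m, hm0, hm⟩ := exists_lower_bound_deriv_sq hD hf hf' hUc hUD ⟨x₀, subset_closure hx₀⟩
  have hα := hW.continuous_clockInvFun hD hf hU hUD hx₀ hm0 hm hT.symm
  have hfc : ContinuousOn (fun v : Fin 2 → ℝ ↦ f (toC v)) (closure U) :=
    (hf.continuousOn.comp continuous_toC.continuousOn fun v hv ↦ hv).mono hUD
  have e : (fun u ↦ tcPos x₀ W f U u ω) = fun u ↦ f (toC (confPos x₀ W U (clockInvFun x₀ W f U ω u) ω)) := rfl
  rw [e]
  exact hfc.comp_continuous ((hW.continuous_confPos ω).comp hα) fun u ↦ hW.confPos_mem_closure hU hx₀ _ ω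

/-- **On `{ρ < ∞}` the enlarged process has continuous paths.** [folklore] -/
theorem continuous_tcEnl_of_ne_top (hW : IsBrownianVec W P) (hW' : IsBrownianVec W' P') (hD : IsOpen D)
    (hf : DifferentiableOn ℂ f D) (hf' : ∀ z ∈ D, deriv f z ≠ 0) (hU : IsOpen U) (hUc : IsCompact (closure U))
    (hUD : closure U ⊆ toC ⁻¹' D) (hx₀ : x₀ ∈ U) {p : Ω × Ω'} (hρ : hitTime x₀ W Uᶜ p.1 ≠ ⊤) :
    Continuous fun u ↦ tcEnl x₀ W f U W' u p := by
  unfold tcEnl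
  refine (hW.continuous_tcPos_of_ne_top hD hf hf' hU hUc hUD hx₀ hρ).add (continuous_toC.comp ?_)
  exact (hW'.continuous_path p.2).comp
    (continuous_real_toNNReal.comp (NNReal.continuous_coe.sub continuous_const))

/-! ### The law on path space -/

section Law

variable [IsProbabilityMeasure P] [IsProbabilityMeasure P'] [MeasurableSpace C(ℝ≥0, ℂ)] [BorelSpace C(ℝ≥0, ℂ)]

/-- **The enlarged time-changed process is, in law, the planar Brownian motion `f(x₀) + W'`**: the
law of its path (read as an element of `C(ℝ≥0, ℂ)`, with a junk value on the null set
`{ρ = ∞}`) equals the law of the path of `f(x₀) + W'` ([Lawler] Thm. 2.2, [Le Gall] Thm. 5.13 /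
Thm. 7.19: the time-changed conformal martingale, continued by an independent Brownian motion
after its total clock, is a Brownian motion). [cite: Lawler2005ConformallyInvariant, Thm. 2.2] -/
theorem map_mkD_tcEnl_eq (hW : IsBrownianVec W P) (hW' : IsBrownianVec W' P') (hD : IsOpen D)
    (hf : DifferentiableOn ℂ f D) (hf' : ∀ z ∈ D, deriv f z ≠ 0) (hU : IsOpen U)
    (hUb : Bornology.IsBounded U) (hUD : closure U ⊆ toC ⁻¹' D) (hx₀ : x₀ ∈ U) :
    (P.prod P').map (fun p ↦ ContinuousMap.mkD (fun u ↦ tcEnl x₀ W f U W' u p) 0) =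
      P'.map (fun ω' ↦ (⟨fun u ↦ f (toC x₀) + toC (W' u ω'),
        continuous_const.add (continuous_toC.comp (hW'.continuous_path ω'))⟩ : C(ℝ≥0, ℂ))) := by
  classical
  have hUc : IsCompact (closure U) := hUb.isCompact_closure
  -- the good set and the regularised process
  set G : Set (Ω × Ω') := {p | hitTime x₀ W Uᶜ p.1 ≠ ⊤} with hG
  have hρm : Measurable (hitTime x₀ W Uᶜ : Ω → WithTop ℝ≥0) :=
    (hW.isStoppingTime_hitTime (x₀ := x₀) hU.isClosed_compl).measurable'
  have hGm : MeasurableSet G := by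
    have : G = Prod.fst ⁻¹' ((hitTime x₀ W Uᶜ) ⁻¹' {⊤})ᶜ := by ext p; simp [hG]
    rw [this]
    exact (hρm (measurableSet_singleton _)).compl.preimage measurable_fst
  have hGae : ∀ᵐ p ∂(P.prod P'), p ∈ G :=
    (Measure.quasiMeasurePreserving_fst (μ := P) (ν := P')).ae (hW.ae_hitTime_ne_top hU hUb hx₀)
  set Z : ℝ≥0 → Ω × Ω' → ℂ := fun u p ↦ if p ∈ G then tcEnl x₀ W f U W' u p else f (toC x₀) with hZ
  have hZm : ∀ u, Measurable (Z u) := fun u ↦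
    Measurable.ite hGm (hW.measurable_tcEnl hW' hD hf hU hUD hx₀ u) measurable_const
  have hZc : ∀ p, Continuous (Z · p) := fun p ↦ by
    by_cases hp : p ∈ G
    · simp only [hZ, hp, ↓reduceIte]
      exact hW.continuous_tcEnl_of_ne_top hW' hD hf hf' hU hUc hUD hx₀ hp
    · simp only [hZ, hp, ↓reduceIte]
      exact continuous_const
  have hZ0 : ∀ p, Z 0 p = f (toC x₀) := fun p ↦ by
    by_cases hp : p ∈ G
    · simp only [hZ, hp, ↓reduceIte]; exact hW.tcEnl_zero hW' hD hf hU hUD hx₀ p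
    · simp only [hZ, hp, ↓reduceIte]
  have hZae : ∀ u, Z u =ᵐ[P.prod P'] tcEnl x₀ W f U W' u := fun u ↦ by
    filter_upwards [hGae] with p hp
    simp only [hZ, hp, ↓reduceIte]
  -- the reference Brownian motion `f(x₀) + W'`
  set R : ℝ≥0 → Ω' → ℂ := fun u ω' ↦ f (toC x₀) + toC (W' u ω') with hR
  have hRm : ∀ u, Measurable (R u) := fun u ↦ measurable_const.add (measurable_toC.comp (hW'.measurable u))
  have hRc : ∀ ω', Continuous (R · ω') := fun ω' ↦ continuous_const.add (continuous_toC.comp (hW'.continuous_path ω'))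
  have hR0 : ∀ ω', R 0 ω' = f (toC x₀) := fun ω' ↦ by simp [hR, hW'.apply_zero]
  -- increment characteristic functions agree
  have hcf : ∀ u : ℕ → ℝ≥0, Monotone u → u 0 = 0 → ∀ (θ : ℕ → ℂ) (n : ℕ),
      ∫ p, cexp (I * (∑ j ∈ Finset.range n, (conj (θ j) * (Z (u (j + 1)) p - Z (u j) p)).re : ℝ)) ∂(P.prod P') =
      ∫ ω', cexp (I * (∑ j ∈ Finset.range n, (conj (θ j) * (R (u (j + 1)) ω' - R (u j) ω')).re : ℝ)) ∂P' := by
    intro u hu _ θ n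
    -- left: replace `Z` by `β̃` almost surely and use the enlargement identity
    have hl : ∫ p, cexp (I * (∑ j ∈ Finset.range n, (conj (θ j) * (Z (u (j + 1)) p - Z (u j) p)).re : ℝ)) ∂(P.prod P') =
        ∏ j ∈ Finset.range n, cexp (-(((u (j + 1) : ℝ) - u j) * ‖θ j‖ ^ 2 / 2 : ℝ)) := by
      rw [← hW.integral_cexp_sum_tcEnl_incr hW' hD hf hU hUb hUD hx₀ hu θ n]
      refine integral_congr_ae ?_
      filter_upwards [hGae] with p hp
      simp only [hZ, hp, ↓reduceIte]
    -- right: increments of a planar Brownian motion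
    have hr : ∫ ω', cexp (I * (∑ j ∈ Finset.range n, (conj (θ j) * (R (u (j + 1)) ω' - R (u j) ω')).re : ℝ)) ∂P' =
        ∏ j ∈ Finset.range n, cexp (-(((u (j + 1) : ℝ) - u j) * ‖θ j‖ ^ 2 / 2 : ℝ)) := by
      have e : ∀ ω', (∑ j ∈ Finset.range n, (conj (θ j) * (R (u (j + 1)) ω' - R (u j) ω')).re) =
          ∑ j ∈ Finset.range n, ∑ i, ![(θ j).re, (θ j).im] i * (W' (u (j + 1)) ω' - W' (u j) ω') i := by
        intro ω'
        refine Finset.sum_congr rfl fun j _ ↦ ?_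
        have : R (u (j + 1)) ω' - R (u j) ω' = toC (W' (u (j + 1)) ω' - W' (u j) ω') := by
          simp only [hR, toC_sub]; ring
        rw [this, re_conj_mul_toC]
      simp_rw [e]
      rw [hW'.integral_cexp_sum_incr hu (fun j ↦ ![(θ j).re, (θ j).im]) n]
      simp_rw [sum_sq_reIm]
    rw [hl, hr]
  -- laws on path space
  have hlaw := map_path_eq_of_incr (P₁ := P.prod P') (P₂ := P') hZm hRm hZc hRc hZ0 hR0 hcf
  -- replace the regularised path by `mkD` of the enlarged process (equal almost surely)
  have hpath : (fun p ↦ ContinuousMap.mkD (fun u ↦ tcEnl x₀ W f U W' u p) 0) =ᵐ[P.prod P']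
      fun p ↦ (⟨fun u ↦ Z u p, hZc p⟩ : C(ℝ≥0, ℂ)) := by
    filter_upwards [hGae] with p hp
    have hc : Continuous fun u ↦ tcEnl x₀ W f U W' u p := hW.continuous_tcEnl_of_ne_top hW' hD hf hf' hU hUc hUD hx₀ hp
    rw [ContinuousMap.mkD_of_continuous hc]
    ext u
    simp [hZ, hp]
  rw [Measure.map_congr hpath, hlaw]

omit [IsProbabilityMeasure P] [IsProbabilityMeasure P'] in
/-- The path of the reference Brownian motion `y₀ + W'` is a measurable random element of
`C(ℝ≥0, ℂ)`. [folklore] -/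
theorem measurable_refPath (hW' : IsBrownianVec W' P') (y₀ : ℂ) :
    Measurable fun ω' ↦ (⟨fun u ↦ y₀ + toC (W' u ω'),
      continuous_const.add (continuous_toC.comp (hW'.continuous_path ω'))⟩ : C(ℝ≥0, ℂ)) := by
  have := measurable_continuousMap_of_eval (Φ := fun ω' ↦ (⟨fun u ↦ y₀ + toC (W' u ω'),
      continuous_const.add (continuous_toC.comp (hW'.continuous_path ω'))⟩ : C(ℝ≥0, ℂ)))
    fun a ↦ measurable_const.add (measurable_toC.comp (hW'.measurable a))
  rwa [← BorelSpace.measurable_eq] at this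

omit [IsProbabilityMeasure P'] in
/-- The `mkD`-path of the enlarged time-changed process is a.e. measurable (it is a.e. equal to
the path of a continuous modification). [folklore] -/
theorem aemeasurable_mkD_tcEnl (hW : IsBrownianVec W P) (hW' : IsBrownianVec W' P') (hD : IsOpen D)
    (hf : DifferentiableOn ℂ f D) (hf' : ∀ z ∈ D, deriv f z ≠ 0) (hU : IsOpen U)
    (hUb : Bornology.IsBounded U) (hUD : closure U ⊆ toC ⁻¹' D) (hx₀ : x₀ ∈ U) :
    AEMeasurable (fun p ↦ ContinuousMap.mkD (fun u ↦ tcEnl x₀ W f U W' u p) 0) (P.prod P') := by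
  classical
  have hUc : IsCompact (closure U) := hUb.isCompact_closure
  set G : Set (Ω × Ω') := {p | hitTime x₀ W Uᶜ p.1 ≠ ⊤} with hG
  have hρm : Measurable (hitTime x₀ W Uᶜ : Ω → WithTop ℝ≥0) :=
    (hW.isStoppingTime_hitTime (x₀ := x₀) hU.isClosed_compl).measurable'
  have hGm : MeasurableSet G := by
    have : G = Prod.fst ⁻¹' ((hitTime x₀ W Uᶜ) ⁻¹' {⊤})ᶜ := by ext p; simp [hG]
    rw [this]
    exact (hρm (measurableSet_singleton _)).compl.preimage measurable_fst
  have hGae : ∀ᵐ p ∂(P.prod P'), p ∈ G :=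
    (Measure.quasiMeasurePreserving_fst (μ := P) (ν := P')).ae (hW.ae_hitTime_ne_top hU hUb hx₀)
  set Z : ℝ≥0 → Ω × Ω' → ℂ := fun u p ↦ if p ∈ G then tcEnl x₀ W f U W' u p else f (toC x₀) with hZ
  have hZm : ∀ u, Measurable (Z u) := fun u ↦
    Measurable.ite hGm (hW.measurable_tcEnl hW' hD hf hU hUD hx₀ u) measurable_const
  have hZc : ∀ p, Continuous (Z · p) := fun p ↦ by
    by_cases hp : p ∈ G
    · simp only [hZ, hp, ↓reduceIte]
      exact hW.continuous_tcEnl_of_ne_top hW' hD hf hf' hU hUc hUD hx₀ hp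
    · simp only [hZ, hp, ↓reduceIte]
      exact continuous_const
  have hpm : Measurable fun p ↦ (⟨fun u ↦ Z u p, hZc p⟩ : C(ℝ≥0, ℂ)) := by
    have := measurable_continuousMap_of_eval (Φ := fun p ↦ (⟨fun u ↦ Z u p, hZc p⟩ : C(ℝ≥0, ℂ))) fun a ↦ hZm a
    rwa [← BorelSpace.measurable_eq] at this
  refine ⟨_, hpm, ?_⟩
  filter_upwards [hGae] with p hp
  have hc : Continuous fun u ↦ tcEnl x₀ W f U W' u p := hW.continuous_tcEnl_of_ne_top hW' hD hf hf' hU hUc hUD hx₀ hp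
  rw [ContinuousMap.mkD_of_continuous hc]
  ext u
  simp [hZ, hp]

end Law

end IsBrownianVec

end Literature.Probability.Process

end
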